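import Mathlib
import Summits.QuantumFields.YangMills.Theorems.ConvexGribovBodyContinuumLegGivenGapCsclTorusForms
import Summits.QuantumFields.YangMills.Theorems.ConvexGribovBodyContinuumLegGivenGapStubCsclLattice
import Summits.QuantumFields.YangMills.Theorems.ParabolicTrajectoryContinuumLimitOnTrajectoryStubArpA
import HarnessLib

/-!
# `ContinuumLegGivenGap` (stmt-QuantumFields-15828), line `Sketch`, reshape 18b: `stub_csclNearFar` — sup-norm perturbation of centred pairings; near/far split of representatives

Support file for the crux item stmt-QuantumFields-15828 (registered glue stub `stub_csclNearFar` of line `Sketch`, reshape 18b).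

Two elementary estimates consumed by `stub_csclKLevel`.

* (1) **Sup-norm perturbation of centred pairings.** On the torus of side `2S+1` at `β`, with
  `𝒫_σ(X,Y) = ∫ conj X(Θ₀Ũ) · Y(τ^σ Ũ) dμ`, `E X = ∫ X(Ũ) dμ` (`μ` Wilson's torus measure, a probability measure;
  `Ũ = torusLift`, `Θ₀ = cfgReflect`, `τ^σ = configShift (−σ e₀)`) and the centred pairing
  `𝒫°_σ(X,Y) = 𝒫_σ(X,Y) − conj(E X) E Y`: if `‖X‖, ‖X'‖ ≤ BX`, `‖Y‖, ‖Y'‖ ≤ BY`, `‖X − X'‖ ≤ ηX`, `‖Y − Y'‖ ≤ ηY`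
  pointwise, then `‖𝒫°_σ(X,Y) − 𝒫°_σ(X',Y')‖ ≤ 2 (ηX BY + BX ηY)` (`conj X·Y − conj X'·Y' = conj(X−X')·Y + conj X'·(Y−Y')`
  under the integral and on the means, `‖∫ f‖ ≤ sup ‖f‖` on a probability space). Abstract form:
  `csclNearFar_centred_perturb`.
* (2) **Near/far split of lattice representatives.** For `R ≤ L`, `|P| ≤ MP`, `|mc|, |mc'| ≤ MP`:
  `‖∑_{x ∈ (box L)ⁿ} F(a x⃗) ∏ᵢ (P(τ_{xᵢ}V) − mc) − ∑_{x ∈ (box R)ⁿ} F(a x⃗) ∏ᵢ (P(τ_{xᵢ}V) − mc')‖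
   ≤ (2MP+1)ⁿ ∑_{x ∈ (box L)ⁿ, x ∉ (box R)ⁿ} ‖F(a x⃗)‖ + n (2MP+1)ⁿ |mc − mc'| ∑_{x ∈ (box L)ⁿ} ‖F(a x⃗)‖`
  (re-index the `(box R)ⁿ` sum as the near part of the `(box L)ⁿ` sum via `Arp.sum_boxFun_eq`; far strings are bounded
  by `‖F‖ (2MP+1)ⁿ` (`csclNearFar_norm_prod_le`), near strings by the telescoping estimate
  `‖∏ pᵢ − ∏ qᵢ‖ ≤ n Cⁿ δ` for `‖pᵢ‖, ‖qᵢ‖ ≤ C`, `1 ≤ C`, `‖pᵢ − qᵢ‖ ≤ δ` (`csclNearFar_norm_prod_sub_prod_le`)).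

No definitions, no facts; Mathlib + landed tree lemmas only. [folklore]
-/

noncomputable section

namespace Summit.QuantumFields.YangMills.Theorems.ContinuumLegGivenGap

open scoped SchwartzMap ComplexConjugate
open Filter Topology MeasureTheory
open Literature.MathematicalPhysics.QuantumFieldTheory Literature.MathematicalPhysics.QuantumLattice
  Literature.MathematicalPhysics.AQFT Literature.Probability.LatticeModels
open Summit.QuantumFields.YangMills.Cruxes.ContinuumLimitOnTrajectory.TwoOrbitSynchronisation (curvDistribution)

/-! ### Helpers: products of bounded complex numbers -/

/-- A product of `n` complex numbers of norm `≤ C` has norm `≤ C ^ n`. [folklore] -/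
theorem csclNearFar_norm_prod_le {n : ℕ} {C : ℝ} (p : Fin n → ℂ) (hp : ∀ i, ‖p i‖ ≤ C) :
    ‖∏ i, p i‖ ≤ C ^ n := by
  rw [norm_prod]
  calc ∏ i, ‖p i‖ ≤ ∏ _i : Fin n, C := Finset.prod_le_prod (fun i _ => norm_nonneg _) fun i _ => hp i
    _ = C ^ n := Fin.prod_const n C

/-- **Telescoping estimate**: for `‖pᵢ‖, ‖qᵢ‖ ≤ C` with `1 ≤ C` and `‖pᵢ − qᵢ‖ ≤ δ`,
`‖∏ᵢ pᵢ − ∏ᵢ qᵢ‖ ≤ n Cⁿ δ` (induction on `n`, `p₀A − q₀B = (p₀ − q₀)A + q₀(A − B)`). [folklore] -/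
theorem csclNearFar_norm_prod_sub_prod_le (C δ : ℝ) (hC : 1 ≤ C) :
    ∀ (n : ℕ) (p q : Fin n → ℂ), (∀ i, ‖p i‖ ≤ C) → (∀ i, ‖q i‖ ≤ C) → (∀ i, ‖p i - q i‖ ≤ δ) →
      ‖∏ i, p i - ∏ i, q i‖ ≤ n * C ^ n * δ := by
  intro n
  induction n with
  | zero => intro p q _ _ _; simp
  | succ n ih =>
    intro p q hp hq hpq
    have hδ : 0 ≤ δ := (norm_nonneg _).trans (hpq 0)
    have hC0 : 0 ≤ C := zero_le_one.trans hC
    have hA : ‖∏ i : Fin n, p i.succ‖ ≤ C ^ n := csclNearFar_norm_prod_le _ fun i => hp _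
    have hAB : ‖∏ i : Fin n, p i.succ - ∏ i : Fin n, q i.succ‖ ≤ n * C ^ n * δ :=
      ih (fun i => p i.succ) (fun i => q i.succ) (fun i => hp _) (fun i => hq _) fun i => hpq _
    rw [Fin.prod_univ_succ, Fin.prod_univ_succ]
    calc ‖p 0 * ∏ i : Fin n, p i.succ - q 0 * ∏ i : Fin n, q i.succ‖
        = ‖(p 0 - q 0) * ∏ i : Fin n, p i.succ + q 0 * (∏ i : Fin n, p i.succ - ∏ i : Fin n, q i.succ)‖ := by
          congr 1; ring
      _ ≤ ‖p 0 - q 0‖ * ‖∏ i : Fin n, p i.succ‖ + ‖q 0‖ * ‖∏ i : Fin n, p i.succ - ∏ i : Fin n, q i.succ‖ := by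
          rw [← norm_mul, ← norm_mul]; exact norm_add_le _ _
      _ ≤ δ * C ^ n + C * (n * C ^ n * δ) :=
          add_le_add (mul_le_mul (hpq 0) hA (norm_nonneg _) hδ) (mul_le_mul (hq 0) hAB (norm_nonneg _) hC0)
      _ ≤ ((n + 1 : ℕ) : ℝ) * C ^ (n + 1) * δ := by
          have h1 : δ * C ^ n * 1 ≤ δ * C ^ n * C := mul_le_mul_of_nonneg_left hC (by positivity)
          have h2 : ((n + 1 : ℕ) : ℝ) * C ^ (n + 1) * δ = δ * C ^ n * C + C * (n * C ^ n * δ) := by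
            push_cast; ring
          rw [h2]; linarith

/-! ### Helper: perturbation of centred pairings on an abstract probability space -/

/-- **Sup-norm perturbation of a centred pairing** (abstract form of part (1)): on a probability space, for bounded
measurable `xR, xR', yS, yS', gX, gX', gY, gY'` with `‖xR‖,‖xR'‖,‖gX‖,‖gX'‖ ≤ BX`, `‖yS‖,‖yS'‖,‖gY‖,‖gY'‖ ≤ BY`,
`‖xR − xR'‖, ‖gX − gX'‖ ≤ ηX`, `‖yS − yS'‖, ‖gY − gY'‖ ≤ ηY` pointwise,
`‖(∫ conj xR · yS − conj(∫ gX) ∫ gY) − (∫ conj xR' · yS' − conj(∫ gX') ∫ gY')‖ ≤ 2 (ηX BY + BX ηY)`. [folklore] -/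
theorem csclNearFar_centred_perturb {Ω : Type*} [MeasurableSpace Ω] (μ : Measure Ω) [IsProbabilityMeasure μ]
    (xR xR' yS yS' gX gX' gY gY' : Ω → ℂ) (BX BY ηX ηY : ℝ) (hBX : 0 ≤ BX) (hηX : 0 ≤ ηX)
    (mxR : Measurable xR) (mxR' : Measurable xR') (myS : Measurable yS) (myS' : Measurable yS')
    (mgX : Measurable gX) (mgX' : Measurable gX') (mgY : Measurable gY) (mgY' : Measurable gY')
    (bxR : ∀ U, ‖xR U‖ ≤ BX) (bxR' : ∀ U, ‖xR' U‖ ≤ BX) (byS : ∀ U, ‖yS U‖ ≤ BY) (byS' : ∀ U, ‖yS' U‖ ≤ BY)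
    (bgX : ∀ U, ‖gX U‖ ≤ BX) (bgX' : ∀ U, ‖gX' U‖ ≤ BX) (bgY : ∀ U, ‖gY U‖ ≤ BY) (bgY' : ∀ U, ‖gY' U‖ ≤ BY)
    (dxR : ∀ U, ‖xR U - xR' U‖ ≤ ηX) (dyS : ∀ U, ‖yS U - yS' U‖ ≤ ηY)
    (dgX : ∀ U, ‖gX U - gX' U‖ ≤ ηX) (dgY : ∀ U, ‖gY U - gY' U‖ ≤ ηY) :
    ‖((∫ U, conj (xR U) * yS U ∂μ) - conj (∫ U, gX U ∂μ) * (∫ U, gY U ∂μ)) -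
        ((∫ U, conj (xR' U) * yS' U ∂μ) - conj (∫ U, gX' U ∂μ) * (∫ U, gY' U ∂μ))‖ ≤
      2 * (ηX * BY + BX * ηY) := by
  -- bounded measurable functions on a probability space are integrable, with small means if small
  have hint : ∀ {f : Ω → ℂ} (C : ℝ), Measurable f → (∀ U, ‖f U‖ ≤ C) → Integrable f μ :=
    fun C hf hb => Integrable.of_bound hf.aestronglyMeasurable C (Eventually.of_forall hb)
  have hmean : ∀ {f : Ω → ℂ} (C : ℝ), (∀ U, ‖f U‖ ≤ C) → ‖∫ U, f U ∂μ‖ ≤ C := fun C hb => by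
    simpa only [probReal_univ, mul_one] using
      norm_integral_le_of_norm_le_const (μ := μ) (Eventually.of_forall hb)
  have hf : Integrable (fun U => conj (xR U) * yS U) μ :=
    hint (BX * BY) ((Complex.continuous_conj.measurable.comp mxR).mul myS) fun U => by
      rw [norm_mul, Complex.norm_conj]; exact mul_le_mul (bxR U) (byS U) (norm_nonneg _) hBX
  have hf' : Integrable (fun U => conj (xR' U) * yS' U) μ :=
    hint (BX * BY) ((Complex.continuous_conj.measurable.comp mxR').mul myS') fun U => by
      rw [norm_mul, Complex.norm_conj]; exact mul_le_mul (bxR' U) (byS' U) (norm_nonneg _) hBX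
  -- the pairing difference
  have h1 : ‖(∫ U, conj (xR U) * yS U ∂μ) - ∫ U, conj (xR' U) * yS' U ∂μ‖ ≤ ηX * BY + BX * ηY := by
    rw [← integral_sub hf hf']
    refine hmean _ fun U => ?_
    have : conj (xR U) * yS U - conj (xR' U) * yS' U =
        conj (xR U - xR' U) * yS U + conj (xR' U) * (yS U - yS' U) := by
      rw [map_sub]; ring
    rw [this]
    refine (norm_add_le _ _).trans (add_le_add ?_ ?_)
    · rw [norm_mul, Complex.norm_conj]; exact mul_le_mul (dxR U) (byS U) (norm_nonneg _) hηX
    · rw [norm_mul, Complex.norm_conj]; exact mul_le_mul (bxR' U) (dyS U) (norm_nonneg _) hBX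
  -- the product of the means
  have h2 : ‖conj (∫ U, gX U ∂μ) * (∫ U, gY U ∂μ) - conj (∫ U, gX' U ∂μ) * (∫ U, gY' U ∂μ)‖ ≤
      ηX * BY + BX * ηY := by
    have hX : ‖(∫ U, gX U ∂μ) - ∫ U, gX' U ∂μ‖ ≤ ηX := by
      rw [← integral_sub (hint BX mgX bgX) (hint BX mgX' bgX')]; exact hmean _ dgX
    have hY : ‖(∫ U, gY U ∂μ) - ∫ U, gY' U ∂μ‖ ≤ ηY := by
      rw [← integral_sub (hint BY mgY bgY) (hint BY mgY' bgY')]; exact hmean _ dgY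
    have : conj (∫ U, gX U ∂μ) * (∫ U, gY U ∂μ) - conj (∫ U, gX' U ∂μ) * (∫ U, gY' U ∂μ) =
        conj ((∫ U, gX U ∂μ) - ∫ U, gX' U ∂μ) * (∫ U, gY U ∂μ) +
          conj (∫ U, gX' U ∂μ) * ((∫ U, gY U ∂μ) - ∫ U, gY' U ∂μ) := by
      rw [map_sub]; ring
    rw [this]
    refine (norm_add_le _ _).trans (add_le_add ?_ ?_)
    · rw [norm_mul, Complex.norm_conj]; exact mul_le_mul hX (hmean _ bgY) (norm_nonneg _) hηX
    · rw [norm_mul, Complex.norm_conj]; exact mul_le_mul (hmean _ bgX') hY (norm_nonneg _) hBX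
  calc _ = ‖((∫ U, conj (xR U) * yS U ∂μ) - ∫ U, conj (xR' U) * yS' U ∂μ) -
          (conj (∫ U, gX U ∂μ) * (∫ U, gY U ∂μ) - conj (∫ U, gX' U ∂μ) * (∫ U, gY' U ∂μ))‖ := by
        congr 1; ring
    _ ≤ ‖(∫ U, conj (xR U) * yS U ∂μ) - ∫ U, conj (xR' U) * yS' U ∂μ‖ +
          ‖conj (∫ U, gX U ∂μ) * (∫ U, gY U ∂μ) - conj (∫ U, gX' U ∂μ) * (∫ U, gY' U ∂μ)‖ := norm_sub_le _ _
    _ ≤ (ηX * BY + BX * ηY) + (ηX * BY + BX * ηY) := add_le_add h1 h2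
    _ = 2 * (ηX * BY + BX * ηY) := by ring

/-! ### The registered stub -/

/-- **`stub_csclNearFar`** (line `Sketch`, reshape 18b). (1) On the torus of side `2S+1` at `β`, the centred pairing
`𝒫°_σ(X,Y) = ∫ conj X(Θ₀Ũ) Y(τ^σŨ) dμ − conj(∫ X(Ũ) dμ) ∫ Y(Ũ) dμ` of bounded measurable complex observables moves by
at most `2 (ηX BY + BX ηY)` under sup-norm perturbations `‖X − X'‖ ≤ ηX`, `‖Y − Y'‖ ≤ ηY` of observables bounded by
`BX`, `BY` (Wilson's torus measure is a probability measure). (2) For `R ≤ L` the lattice representatives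
`∑_{x ∈ (box L)ⁿ} F(a x⃗) ∏ᵢ (P(τ_{xᵢ}V) − mc)` and `∑_{x ∈ (box R)ⁿ} F(a x⃗) ∏ᵢ (P(τ_{xᵢ}V) − mc')` (`P` the Wilson
action density, `|P|, |mc|, |mc'| ≤ MP`) differ pointwise by at most
`(2MP+1)ⁿ ∑_{far x} ‖F(a x⃗)‖ + n (2MP+1)ⁿ |mc − mc'| ∑ₓ ‖F(a x⃗)‖`, "far" meaning some `xᵢ ∉ box R`. [folklore] -/
theorem stub_csclNearFar :
    ∀ (G : Type) [Group G] [TopologicalSpace G] [IsTopologicalGroup G] [CompactSpace G]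
      [MeasurableSpace G] [BorelSpace G] (r : LatticeRep G) (β : ℝ),
      (∀ (S : ℕ) (X X' Y Y' : LGConfig 4 G → ℂ) (BX BY ηX ηY : ℝ), Measurable X → Measurable X' → Measurable Y →
        Measurable Y' → (∀ V, ‖X V‖ ≤ BX) → (∀ V, ‖X' V‖ ≤ BX) → (∀ V, ‖Y V‖ ≤ BY) → (∀ V, ‖Y' V‖ ≤ BY) →
        (∀ V, ‖X V - X' V‖ ≤ ηX) → (∀ V, ‖Y V - Y' V‖ ≤ ηY) → ∀ σ : ℕ,
        ‖((∫ U : GaugeConfig 4 (2 * S + 1) G, (starRingEnd ℂ) (X (cfgReflect (torusLift (2 * S + 1) U))) * Y (configShift (-(Pi.single 0 ((σ : ℕ) : ℤ))) (torusLift (2 * S + 1) U)) ∂(wilsonMeasure r.ρ β)) - (starRingEnd ℂ) (∫ U : GaugeConfig 4 (2 * S + 1) G, X (torusLift (2 * S + 1) U) ∂(wilsonMeasure r.ρ β)) * (∫ U : GaugeConfig 4 (2 * S + 1) G, Y (torusLift (2 * S + 1) U) ∂(wilsonMeasure r.ρ β))) -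
            ((∫ U : GaugeConfig 4 (2 * S + 1) G, (starRingEnd ℂ) (X' (cfgReflect (torusLift (2 * S + 1) U))) * Y' (configShift (-(Pi.single 0 ((σ : ℕ) : ℤ))) (torusLift (2 * S + 1) U)) ∂(wilsonMeasure r.ρ β)) - (starRingEnd ℂ) (∫ U : GaugeConfig 4 (2 * S + 1) G, X' (torusLift (2 * S + 1) U) ∂(wilsonMeasure r.ρ β)) * (∫ U : GaugeConfig 4 (2 * S + 1) G, Y' (torusLift (2 * S + 1) U) ∂(wilsonMeasure r.ρ β)))‖ ≤ 2 * (ηX * BY + BX * ηY)) ∧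
      (∀ (n R L : ℕ) (a mc mc' MP : ℝ) (F : SchwartzMap (Fin n → EuclideanSpace ℝ (Fin 4)) ℂ), R ≤ L →
        (∀ U, |r.curvature.F U| ≤ MP) → |mc| ≤ MP → |mc'| ≤ MP → ∀ V : LGConfig 4 G,
        ‖(fun V => ∑ x : Fin n → ↥(box 4 L), F (fun i => a • siteToE ↑(x i)) * ∏ i, ((r.curvature.F (configShift (-↑(x i)) V) - mc : ℝ) : ℂ)) V -
            (fun V => ∑ x : Fin n → ↥(box 4 R), (fun x => F (fun i => a • siteToE ↑(x i))) x * ∏ i, ((r.curvature.F (configShift (-↑(x i)) V) - mc' : ℝ) : ℂ)) V‖ ≤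
          (2 * MP + 1) ^ n * (∑ x : Fin n → ↥(box 4 L),
              if (∀ i, (↑(x i) : Site 4) ∈ box 4 R) then 0 else ‖F (fun i => a • siteToE ↑(x i))‖) +
            n * (2 * MP + 1) ^ n * |mc - mc'| * ∑ x : Fin n → ↥(box 4 L), ‖F (fun i => a • siteToE ↑(x i))‖) := by
  intro G _ _ _ _ _ _ r β
  refine ⟨?_, ?_⟩
  · -- (1) perturbation of centred pairings
    intro S X X' Y Y' BX BY ηX ηY hXm hX'm hYm hY'm hXb hX'b hYb hY'b hXη hYη σ
    haveI := isProbabilityMeasure_wilsonMeasure (d := 4) (L := 2 * S + 1) r.ρ r.continuous β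
    have hBX : 0 ≤ BX := (norm_nonneg _).trans (hXb fun _ => 1)
    have hηX : 0 ≤ ηX := (norm_nonneg _).trans (hXη fun _ => 1)
    have hL : ∀ Z : LGConfig 4 G → ℂ, Measurable Z →
        Measurable fun U : GaugeConfig 4 (2 * S + 1) G => Z (torusLift (2 * S + 1) U) :=
      fun Z hZ => hZ.comp (measurable_torusLift _)
    have hR : ∀ Z : LGConfig 4 G → ℂ, Measurable Z →
        Measurable fun U : GaugeConfig 4 (2 * S + 1) G => Z (cfgReflect (torusLift (2 * S + 1) U)) :=
      fun Z hZ => hZ.comp (measurable_cfgReflect.comp (measurable_torusLift _))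
    exact csclNearFar_centred_perturb (wilsonMeasure (d := 4) (L := 2 * S + 1) r.ρ β)
      (fun U => X (cfgReflect (torusLift (2 * S + 1) U))) (fun U => X' (cfgReflect (torusLift (2 * S + 1) U)))
      (fun U => Y (configShift (-(Pi.single 0 ((σ : ℕ) : ℤ))) (torusLift (2 * S + 1) U)))
      (fun U => Y' (configShift (-(Pi.single 0 ((σ : ℕ) : ℤ))) (torusLift (2 * S + 1) U)))
      (fun U => X (torusLift (2 * S + 1) U)) (fun U => X' (torusLift (2 * S + 1) U))
      (fun U => Y (torusLift (2 * S + 1) U)) (fun U => Y' (torusLift (2 * S + 1) U))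
      BX BY ηX ηY hBX hηX (hR X hXm) (hR X' hX'm) (cscl_measurable_comp hYm _ _).2
      (cscl_measurable_comp hY'm _ _).2 (hL X hXm) (hL X' hX'm) (hL Y hYm) (hL Y' hY'm)
      (fun U => hXb _) (fun U => hX'b _) (fun U => hYb _) (fun U => hY'b _)
      (fun U => hXb _) (fun U => hX'b _) (fun U => hYb _) (fun U => hY'b _)
      (fun U => hXη _) (fun U => hYη _) (fun U => hXη _) (fun U => hYη _)
  · -- (2) near/far split of the lattice representatives
    intro n R L a mc mc' MP F hRL hP hmc hmc' V
    dsimp only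
    have hMP : 0 ≤ MP := (abs_nonneg _).trans (hP V)
    have hC1 : (1 : ℝ) ≤ 2 * MP + 1 := by linarith
    have hCn : (0 : ℝ) ≤ (2 * MP + 1) ^ n := pow_nonneg (by linarith) n
    -- re-index the `(box R)ⁿ` sum as the near part of the `(box L)ⁿ` sum
    have hre : ∑ x : Fin n → ↥(box 4 R), F (fun i => a • siteToE (↑(x i) : Site 4)) *
          ∏ i, ((r.curvature.F (configShift (-(↑(x i) : Site 4)) V) - mc' : ℝ) : ℂ) =
        ∑ x : Fin n → ↥(box 4 L), if (∀ i, (↑(x i) : Site 4) ∈ box 4 R) then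
          F (fun i => a • siteToE (↑(x i) : Site 4)) *
            ∏ i, ((r.curvature.F (configShift (-(↑(x i) : Site 4)) V) - mc' : ℝ) : ℂ) else 0 := by
      rw [Summit.QuantumFields.YangMills.Cruxes.ContinuumLimitOnTrajectory.TwoOrbitSynchronisation.Arp.sum_boxFun_eq
          (fun y : Fin n → Site 4 => F (fun i => a • siteToE (y i)) *
            ∏ i, ((r.curvature.F (configShift (-(y i)) V) - mc' : ℝ) : ℂ)),
        Summit.QuantumFields.YangMills.Cruxes.ContinuumLimitOnTrajectory.TwoOrbitSynchronisation.Arp.sum_boxFun_eq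
          (fun y : Fin n → Site 4 => if (∀ i, y i ∈ box 4 R) then F (fun i => a • siteToE (y i)) *
            ∏ i, ((r.curvature.F (configShift (-(y i)) V) - mc' : ℝ) : ℂ) else 0),
        ← Finset.sum_filter]
      congr 1
      ext y
      simp only [Finset.mem_filter, Fintype.mem_piFinset]
      exact ⟨fun h => ⟨fun i => box_mono 4 hRL (h i), h⟩, fun h => h.2⟩
    rw [hre, ← Finset.sum_sub_distrib]
    refine (norm_sum_le _ _).trans ?_
    rw [Finset.mul_sum, Finset.mul_sum, ← Finset.sum_add_distrib]
    refine Finset.sum_le_sum fun x _ => ?_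
    -- bounds on the factors of the string `x`
    have hp : ∀ m : ℝ, |m| ≤ MP → ∀ i : Fin n,
        ‖((r.curvature.F (configShift (-(↑(x i) : Site 4)) V) - m : ℝ) : ℂ)‖ ≤ 2 * MP + 1 := by
      intro m hm i
      rw [Complex.norm_real, Real.norm_eq_abs]
      calc |r.curvature.F (configShift (-(↑(x i) : Site 4)) V) - m|
          ≤ |r.curvature.F (configShift (-(↑(x i) : Site 4)) V)| + |m| := abs_sub _ _
        _ ≤ MP + MP := add_le_add (hP _) hm
        _ ≤ 2 * MP + 1 := by linarith
    have hprod : ‖∏ i, ((r.curvature.F (configShift (-(↑(x i) : Site 4)) V) - mc : ℝ) : ℂ)‖ ≤ (2 * MP + 1) ^ n :=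
      csclNearFar_norm_prod_le _ (hp mc hmc)
    have hdiff : ‖∏ i, ((r.curvature.F (configShift (-(↑(x i) : Site 4)) V) - mc : ℝ) : ℂ) -
        ∏ i, ((r.curvature.F (configShift (-(↑(x i) : Site 4)) V) - mc' : ℝ) : ℂ)‖ ≤
          n * (2 * MP + 1) ^ n * |mc - mc'| :=
      csclNearFar_norm_prod_sub_prod_le (2 * MP + 1) |mc - mc'| hC1 n _ _ (hp mc hmc) (hp mc' hmc') fun i => by
        rw [← Complex.ofReal_sub, Complex.norm_real, Real.norm_eq_abs, sub_sub_sub_cancel_left, abs_sub_comm]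
    split_ifs with hnear
    · -- near string: only the centring constant moves
      rw [← mul_sub, norm_mul, mul_zero, zero_add]
      exact (mul_le_mul_of_nonneg_left hdiff (norm_nonneg _)).trans_eq (mul_comm _ _)
    · -- far string: crude bound
      rw [sub_zero, norm_mul]
      calc ‖F (fun i => a • siteToE (↑(x i) : Site 4))‖ *
            ‖∏ i, ((r.curvature.F (configShift (-(↑(x i) : Site 4)) V) - mc : ℝ) : ℂ)‖
          ≤ ‖F (fun i => a • siteToE (↑(x i) : Site 4))‖ * (2 * MP + 1) ^ n :=
            mul_le_mul_of_nonneg_left hprod (norm_nonneg _)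
        _ = (2 * MP + 1) ^ n * ‖F (fun i => a • siteToE (↑(x i) : Site 4))‖ + 0 := by ring
        _ ≤ (2 * MP + 1) ^ n * ‖F (fun i => a • siteToE (↑(x i) : Site 4))‖ +
              n * (2 * MP + 1) ^ n * |mc - mc'| * ‖F (fun i => a • siteToE (↑(x i) : Site 4))‖ :=
            add_le_add le_rfl (mul_nonneg (mul_nonneg (mul_nonneg (Nat.cast_nonneg _) hCn) (abs_nonneg _))
              (norm_nonneg _))

end Summit.QuantumFields.YangMills.Theorems.ContinuumLegGivenGap

end
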